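import Literature.MathematicalPhysics.QuantumFieldTheory.Balaban1983to89.B10SectCExpansion
import Literature.MathematicalPhysics.QuantumFieldTheory.Balaban1983to89.TreeLengthTorus
import Summits.QuantumFields.Balaban3D.Carriers.Regions

/-!
# Lane `pub-balaban3d` — carrier layer p1 (`Carriers.OldTerms`): the INDEX GEOMETRY of the previous-scale interaction terms
# `𝒫_j(Y_j, ·)`, `Y_j = (y, c₁, …, c_n)` of [Balaban1985UV3] (43) p. 266, concretely over the lane's tori and regions (v1.1 of the
# expansion data; seat p5's row C10 `oldOutside_of_bound44`, lead batch 13 (d))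

Print, (43) p. 266 L27–31 (render `…-p012-x2.png`): «The expressions 𝒫_j(Y_j, U_k) are defined similarly to (35): Y_j = (y, c₁, …, c_n),
where y represents big blocks of L^jη-lattice, contained in Ω_k, i.e. y ∈ Ω_k^{(j)} ∩ M₁L^jηZ³, and c_i are bonds in Ω_k^{(j)},
|c_{i,−} − y| < R(g_j)M₁L^jη, 𝒫_j(Y_j, U_k) = ⟨𝒫_j(Y_j), B_k(c₁), …, B_k(c_n)⟩, n ≥ 2»; p. 272 L29–31: «To get the exact inequality we
estimate a sum of all terms 𝒫_j(Y_j, U_{k+1}) with localizations Y_j not contained in Ω_{k+1} by O(1)|Λ_k|, or by O(1)|Z_k|.»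

WHAT THIS FILE DEFINES ([folklore] combinatorics over `Setup.Site`/`Setup.PBond` and `Carriers.Regions`; nothing of CMP 102 is asserted).
At the passage `k → k+1`, for a history `h ∈ Hist P (k+1)` and an old scale `j`:
* `bigIn M₁ j Ω` — the scale-`j` sites whose BIG block (the `M₁`-cube of `T^{(j)}`) lies inside the fine region `Ω`; `IsCorner` — the
  representative (corner) of a big block; `oldBlocks` = «y ∈ Ω_k^{(j)} ∩ M₁L^jηZ³» (corners of the scale-`j` big blocks inside `Ω_k(h)`);
* `oldBonds … y` = «c bonds in Ω_k^{(j)}, |c₋ − y| < R(g_j)M₁L^jη» (source block inside `Ω_k(h)`, scale-`j` torus distance `< Rcol j`);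
* `Drop … y n c` = «Y_j not contained in Ω_{k+1}» := `y ∉ Ω_{k+1}^{(j)} ∨ ∃ i, c_{i,−} ∉ Ω_{k+1}^{(j)}` (seat p5's reading in
  `Proofs.Run3OldOutside.oldOutside_series`, whose step `hreach` derives the reach property from it via `infDist_le`), with a GLOBAL `Decidable` instance;
* `oldGeom P k j : B10SectCExpansion.VertexGeometry` — LQB's (43)–(45)/(56)–(57) geometry carrier INHABITED: `Site := Site P j`,
  `Bond := PBond P j`, `cminus := src`, `dist x y := ℓ_j·tdist x y` with `ℓ_j = L^{−(k−j)}` the `L^jη`-lattice spacing in the units of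
  `T^{(k)}` (so `ℓ_j⁻¹·dist` = lattice steps, the `(L^jη)^{−1}|c_{i,−} − y|` of (44)), `treeLen bs ys := ℓ_j·𝓛` with 𝓛 = LQB's torus
  tree length `TreeLengthTorus.torusTreeLen` of the bond sources and the extra points ((56)–(57) p. 270 «the length of a shortest graph on
  the unit lattice, connecting points of b_i and possibly other points»; LQB reading D-pv22.1);
* `ΩblkOf M₁ Rcol N h` — the scale-`k` big blocks of `B(Λ_{k+1}(h))` (ruling R-OMEGA: DEFINED) with the counting lemma
  `card_compl_ΩblkOf_le_ZVol : #(blocks ∖ Ω_{k+1}) ≤ |Z_k(h)|` (the `hZ` of C3/C4/C6);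
* `oldSum`/`oldSumIn` — the (43)/(58) sums `Σ_{j=1}^{k} Σ_{Y_j} val` over this index set, all terms / dropped terms replaced by `0`,
  for a degree cutoff `Ndeg` (terms of higher degree sit in the `O((L^kε)^{3+κ₀})` remainder, (57) p. 270 «we estimate terms with an
  overall power greater than six as above») — the shapes `hPold`/`hPoldIn` of seat p5's `abs_pold_sub_poldIn_le` BY `rfl`.
-/

open Finset

namespace Summit.QuantumFields.Balaban3D.Carriers

open Literature.MathematicalPhysics.QuantumFieldTheory.Balaban1983to89
open Literature.MathematicalPhysics.QuantumFieldTheory.Balaban1983to89.B10SectCExpansion (VertexGeometry)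

variable {P : Params}

/-! ## §1 Big blocks inside a region, corners, the (43) index sets -/

section Index

variable (M₁ : ℕ) (Rcol : ℕ → ℕ)

/-- The big-block label of a scale-`j` site (`bigBlockOf M₁ j x = bigLabel M₁ (coarsen j x)`). [folklore] -/
def bigLabel {j : ℕ} (z : Site P j) : Fin P.d → ℕ := fun μ => (z μ).val / M₁

/-- `bigBlockOf` factors through `coarsen` (definitional). [folklore] -/
theorem bigBlockOf_eq_bigLabel (j : ℕ) (x : Site P 0) : bigBlockOf M₁ j x = bigLabel M₁ (coarsen j x) := rfl

open Classical in
/-- The scale-`j` sites whose BIG block (all fine sites `x` with the same scale-`j` big-block label) lies inside the fine region `Ω`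
(«contained in Ω_k, i.e. y ∈ Ω_k^{(j)}», (43) p. 266; Ω is a union of big blocks, (39)). [cite: Balaban1985UV3, (43) p.266] -/
noncomputable def bigIn (j : ℕ) (Ω : Set (Site P 0)) : Finset (Site P j) :=
  univ.filter fun z => ∀ x : Site P 0, bigBlockOf M₁ j x = bigLabel M₁ z → x ∈ Ω

/-- Membership in `bigIn`. [folklore] -/
theorem mem_bigIn {j : ℕ} {Ω : Set (Site P 0)} {z : Site P j} :
    z ∈ bigIn M₁ j Ω ↔ ∀ x : Site P 0, bigBlockOf M₁ j x = bigLabel M₁ z → x ∈ Ω := by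
  classical
  simp [bigIn]

/-- `bigIn` is monotone in the region. [folklore] -/
theorem bigIn_mono (j : ℕ) {Ω Ω' : Set (Site P 0)} (hΩ : Ω ⊆ Ω') : bigIn M₁ j Ω ⊆ bigIn (P := P) M₁ j Ω' :=
  fun _ hz => (mem_bigIn M₁).2 fun x hx => hΩ ((mem_bigIn M₁).1 hz x hx)

/-- The whole torus: every site is in `bigIn … univ`. [folklore] -/
@[simp] theorem bigIn_univ (j : ℕ) : bigIn (P := P) M₁ j Set.univ = univ :=
  eq_univ_of_forall fun _ => (mem_bigIn M₁).2 fun _ _ => Set.mem_univ _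

/-- A site REPRESENTS its big block when it is the block's corner («y ∈ M₁L^jηZ³», (43) p. 266). [cite: Balaban1985UV3, (43) p.266] -/
def IsCorner {j : ℕ} (y : Site P j) : Prop := ∀ μ : Fin P.d, M₁ ∣ (y μ).val

open Classical in
/-- «y represents big blocks of L^jη-lattice, contained in Ω_k, i.e. y ∈ Ω_k^{(j)} ∩ M₁L^jηZ³»: the corners of the scale-`j` big blocks
inside `Ω_k(h)` — the block index of the old terms `𝒫_j(Y_j, ·)` present at the passage `k → k+1`. [cite: Balaban1985UV3, (43) p.266] -/
noncomputable def oldBlocks {k : ℕ} (h : Hist P (k + 1)) (j : ℕ) : Finset (Site P j) :=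
  (bigIn M₁ j (Omega M₁ Rcol k h.proj k)).filter fun y => IsCorner M₁ y

/-- Membership in `oldBlocks`. [folklore] -/
theorem mem_oldBlocks {k : ℕ} {h : Hist P (k + 1)} {j : ℕ} {y : Site P j} :
    y ∈ oldBlocks M₁ Rcol h j ↔ y ∈ bigIn M₁ j (Omega M₁ Rcol k h.proj k) ∧ IsCorner M₁ y := by
  classical
  simp [oldBlocks]

open Classical in
/-- «c_i are bonds in Ω_k^{(j)}, |c_{i,−} − y| < R(g_j)M₁L^jη»: the admissible bonds of an old term at the block `y` — source block inside
`Ω_k(h)`, scale-`j` torus distance to `y` below the collar profile `Rcol j` (= `⌈R₁ r(g_j)⌉·M₁`, ruling R-COL). [cite: Balaban1985UV3, (43) p.266] -/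
noncomputable def oldBonds {k : ℕ} (h : Hist P (k + 1)) (j : ℕ) (y : Site P j) : Finset (PBond P j) :=
  univ.filter fun c => c.src ∈ bigIn M₁ j (Omega M₁ Rcol k h.proj k) ∧ Site.tdist c.src y < Rcol j

/-- Membership in `oldBonds`. [folklore] -/
theorem mem_oldBonds {k : ℕ} {h : Hist P (k + 1)} {j : ℕ} {y : Site P j} {c : PBond P j} :
    c ∈ oldBonds M₁ Rcol h j y ↔ c.src ∈ bigIn M₁ j (Omega M₁ Rcol k h.proj k) ∧ Site.tdist c.src y < Rcol j := by
  classical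
  simp [oldBonds]

/-- The scale-`j` trace of the NEW region: `Ω_{k+1}(h)^{(j)}` = sites whose big block lies inside `Ω_{k+1}(h)` (seat p5's
`Proofs.Run3OldOutside` works with its complement `Z_k(h)^{(j)} = univ \ newSites h j`). [cite: Balaban1985UV3, p.272 L29–31] -/
noncomputable def newSites {k : ℕ} (h : Hist P (k + 1)) (j : ℕ) : Finset (Site P j) :=
  bigIn M₁ j (Omega M₁ Rcol (k + 1) h (k + 1))

/-- **«localizations Y_j not contained in Ω_{k+1}»** (p. 272 L29–31), read as seat p5 does (`Run3OldOutside.oldOutside_series`, step `hreach`): the block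
`y` or one of the bond sources `c_{i,−}` lies outside `Ω_{k+1}(h)^{(j)}`. [cite: Balaban1985UV3, p.272 L29–31] -/
def Drop {k : ℕ} (h : Hist P (k + 1)) (j : ℕ) (y : Site P j) (n : ℕ) (c : Fin n → PBond P j) : Prop :=
  y ∉ newSites M₁ Rcol h j ∨ ∃ i, (c i).src ∉ newSites M₁ Rcol h j

/-- ONE GLOBAL `Decidable` instance for `Drop` (so that every seat's `if Drop … then … else …` elaborates to the same term). [folklore] -/
noncomputable instance decDrop {k : ℕ} (h : Hist P (k + 1)) (j : ℕ) (y : Site P j) (n : ℕ) (c : Fin n → PBond P j) :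
    Decidable (Drop M₁ Rcol h j y n c) := by
  unfold Drop; infer_instance

/-- COHERENCE OF THE INDEX SETS ALONG THE TOWER: the terms RETAINED at the passage `k → k+1` (`¬ Drop`) are exactly those whose block and
bond sources lie in `Ω_{k+1}(h)^{(j)}` — the membership conditions of `oldBlocks`/`oldBonds` one passage later (`newSites h j = bigIn M₁ j
(Ω_{k+1}(h'))` for every extension `h'` of `h`, by `Omega_succ_of_le`). [folklore] -/
theorem newSites_eq_bigIn_proj {k : ℕ} (h' : Hist P (k + 2)) (j : ℕ) :
    newSites M₁ Rcol h'.proj j = bigIn M₁ j (Omega M₁ Rcol (k + 2) h' (k + 1)) := by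
  unfold newSites
  rw [Omega_succ_of_le M₁ Rcol h' le_rfl]

/-- At the trivial history nothing is dropped (`Ω_{k+1} = T_η`, p. 272 L32–33). [folklore] -/
theorem not_drop_triv {k : ℕ} (j : ℕ) (y : Site P j) (n : ℕ) (c : Fin n → PBond P j) :
    ¬ Drop M₁ Rcol (Hist.triv P (k + 1)) j y n c := by
  unfold Drop newSites
  rw [Omega_triv, bigIn_univ]
  simp

/-- **«X ⊂ Ω_{k+1}» — THE BIG BLOCKS OF `B(Λ_{k+1}(h)) = Ω_{k+1}(h)^{(k)}`** (ruling R-OMEGA: DEFINED, never a field): the scale-`k` big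
blocks — `M₁`-cubes of the unit lattice `T^{(k)}`, labelled in `ℤ/N` per direction (`N` = big blocks per direction, the index of LQB's torus
block carrier `TreeLengthTorus.tsys 3 N`) — all of whose fine sites lie inside `Ω_{k+1}(h)` ((59) p. 270 L33–34 «localizations X ⊂ Ω_{k+1},
which are connected unions of big blocks»). [cite: Balaban1985UV3, (59) p.270] -/
noncomputable def ΩblkOf (N : ℕ) [NeZero N] {k : ℕ} (h : Hist P (k + 1)) : Finset (Fin P.d → ZMod N) := by
  classical
  exact univ.filter fun b => ∀ x : Site P 0, bigBlockOf M₁ k x = (fun μ => (b μ).val) → x ∈ Omega M₁ Rcol (k + 1) h (k + 1)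

/-- Membership in `ΩblkOf` (the form of ruling R-OMEGA′ / seat p5's `hΩblk`). [folklore] -/
theorem mem_ΩblkOf {N : ℕ} [NeZero N] {k : ℕ} {h : Hist P (k + 1)} {b : Fin P.d → ZMod N} :
    b ∈ ΩblkOf M₁ Rcol N h ↔
      ∀ x : Site P 0, bigBlockOf M₁ k x = (fun μ => (b μ).val) → x ∈ Omega M₁ Rcol (k + 1) h (k + 1) := by
  classical
  simp [ΩblkOf]

/-- Witness step of `card_compl_ΩblkOf_le_ZVol` (seat p5's former hypothesis `hΩblk`): a block outside `ΩblkOf` carries a fine witness outside `Ω_{k+1}(h)`. [folklore] -/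
theorem exists_witness_of_not_mem_ΩblkOf {N : ℕ} [NeZero N] {k : ℕ} (h : Hist P (k + 1)) (b : Fin P.d → ZMod N)
    (hb : b ∉ ΩblkOf M₁ Rcol N h) :
    ∃ x : Site P 0, bigBlockOf M₁ k x = (fun μ => (b μ).val) ∧ x ∉ Omega M₁ Rcol (k + 1) h (k + 1) := by
  rw [mem_ΩblkOf] at hb
  obtain ⟨x, hx⟩ := not_forall.1 hb
  obtain ⟨hxb, hxΩ⟩ := Classical.not_imp.1 hx
  exact ⟨x, hxb, hxΩ⟩

/-- At the trivial history every big block is in (`Ω_{k+1} = T_η`). [folklore] -/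
@[simp] theorem ΩblkOf_triv (N : ℕ) [NeZero N] (k : ℕ) : ΩblkOf M₁ Rcol N (Hist.triv P (k + 1)) = univ :=
  eq_univ_of_forall fun _ => (mem_ΩblkOf M₁ Rcol).2 fun _ _ => by rw [Omega_triv]; trivial

/-- **THE COUNTING LEMMA `#(blocks ∖ Ω_{k+1}) ≤ |Z_k(h)|`** (ruling R-OMEGA «hZ is a counting lemma about defined objects — owner p1»; the `hZ`
of seats p5/p6's C3/C4/C6): every big block NOT inside `Ω_{k+1}(h)` contains a fine site outside `Ω_{k+1}(h)`, i.e. inside `Z_k(h) =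
Ω_{k+1}(h)ᶜ`, whose scale-`k` site is counted by `ZVol … (k+1) h k`; distinct blocks give distinct sites (the site determines its block
label, `ZMod.val` is injective).  Holds for EVERY `N`. [cite: Balaban1985UV3, p.270 L31 + p.266 L12–13] -/
theorem card_compl_ΩblkOf_le_ZVol (N : ℕ) [NeZero N] {k : ℕ} (h : Hist P (k + 1)) :
    (univ \ ΩblkOf M₁ Rcol N h).card ≤ ZVol M₁ Rcol (k + 1) h k := by
  classical
  -- for each block outside, choose a fine witness outside Ω_{k+1}
  have hw : ∀ b ∈ univ \ ΩblkOf M₁ Rcol N h, ∃ x : Site P 0,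
      bigBlockOf M₁ k x = (fun μ => (b μ).val) ∧ x ∉ Omega M₁ Rcol (k + 1) h (k + 1) :=
    fun b hb => exists_witness_of_not_mem_ΩblkOf M₁ Rcol h b (mem_sdiff.1 hb).2
  choose! w hw₁ hw₂ using hw
  unfold ZVol
  refine le_trans ?_ (card_le_card (s := (univ \ ΩblkOf M₁ Rcol N h).image fun b => coarsen k (w b)) ?_)
  · rw [card_image_of_injOn]
    intro b hb b' hb' hbb'
    have e1 := hw₁ b hb
    have e2 := hw₁ b' hb'
    have hlab : (fun μ => (b μ).val) = fun μ => (b' μ).val := by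
      rw [← e1, ← e2, bigBlockOf_eq_bigLabel, bigBlockOf_eq_bigLabel, show coarsen k (w b) = coarsen k (w b') from hbb']
    funext μ
    exact ZMod.val_injective N (congrFun hlab μ)
  · intro z hz
    obtain ⟨b, hb, rfl⟩ := mem_image.1 hz
    simp only [mem_filter, mem_univ, true_and]
    exact ⟨w b, rfl, by unfold Zreg; exact hw₂ b hb⟩

end Index

/-! ## §2 LQB's geometry carrier of (43)–(45)/(56)–(57) INHABITED at old scale `j` seen from step `k` -/

section Geometry

variable (P)

/-- The `L^jη`-lattice spacing in the units of the current unit lattice `T^{(k)}`: `ℓ_j = L^{−(k−j)}` (seat p5's `hℓ`). [folklore] -/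
noncomputable def ell (k j : ℕ) : ℝ := ((P.L : ℝ)⁻¹) ^ (k - j)

/-- `ℓ_j > 0`. [folklore] -/
theorem ell_pos (k j : ℕ) : 0 < ell P k j := by
  unfold ell
  have := P.L_pos
  positivity

/-- `ℓ_k = 1`. [folklore] -/
@[simp] theorem ell_self (k : ℕ) : ell P k k = 1 := by simp [ell]

open Classical in
/-- **LQB's `VertexGeometry` INHABITED** (the `Xg j` of seat p5's `oldOutside_of_bound44`; `@[reducible]` per ruling R-44 so that its
projections unfold by `rfl`/instance search): sites and positively oriented bonds of `T^{(j)}`,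
`c₋ = src c`, `dist x y = ℓ_j · tdist x y` (so `ℓ_j⁻¹·dist` counts scale-`j` lattice steps, (44)), `treeLen bs ys = ℓ_j · 𝓛(sources of bs ∪ ys)`
with 𝓛 LQB's torus tree length. [cite: Balaban1985UV3, (43) p.266 + (56)–(57) pp.269–270] -/
@[reducible] noncomputable def oldGeom (k j : ℕ) : VertexGeometry where
  Bond := PBond P j
  Site := Site P j
  treeLen bs ys := ell P k j *
    TreeLengthTorus.torusTreeLen (d := P.d) (N := P.sitesPerDir j) ((Set.toFinite bs).toFinset.image PBond.src ∪ (Set.toFinite ys).toFinset)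
  cminus := PBond.src
  dist x y := ell P k j * (Site.tdist x y : ℝ)

/-- Distances of `oldGeom` are non-negative (seat p5's `hdist`). [folklore] -/
theorem oldGeom_dist_nonneg (k j : ℕ) (x y : (oldGeom P k j).Site) : 0 ≤ (oldGeom P k j).dist x y :=
  mul_nonneg (ell_pos P k j).le (Nat.cast_nonneg _)

/-- `ℓ_j⁻¹ · dist x y` is the scale-`j` lattice distance (the `(L^jη)^{−1}|c_{i,−} − y|` of (44)). [folklore] -/
theorem ell_inv_mul_dist (k j : ℕ) (x y : Site P j) :
    (ell P k j)⁻¹ * (oldGeom P k j).dist x y = (Site.tdist x y : ℝ) := by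
  show (ell P k j)⁻¹ * (ell P k j * _) = _
  rw [← mul_assoc, inv_mul_cancel₀ (ell_pos P k j).ne', one_mul]

end Geometry

/-! ## §3 The (43)/(58) sums over the index set: all terms, and with the dropped terms replaced by `0` -/

section Sums

variable (M₁ : ℕ) (Rcol : ℕ → ℕ) {k : ℕ} (Ndeg : ℕ → ℕ)
  (val : Hist P (k + 1) → (j : ℕ) → Site P j → (n : ℕ) → (Fin n → PBond P j) → ℝ)

/-- `Σ_{j=1}^{k} Σ_{Y_j} val(Y_j)` over the (43) index set with degrees `n ≤ Ndeg j` — the «Σ_{j=1}^k Σ_{Y_j} 𝒫_j(Y_j, U_{k+1})» of (58)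
for `val h j y n c = 𝒫_j((y, c), U_{k+1}(h, U))`. [cite: Balaban1985UV3, (58) p.270] -/
noncomputable def oldSum (h : Hist P (k + 1)) : ℝ :=
  ∑ j ∈ Icc 1 k, ∑ y ∈ oldBlocks M₁ Rcol h j, ∑ n ∈ range (Ndeg j + 1),
    ∑ c ∈ Fintype.piFinset (fun _ : Fin n => oldBonds M₁ Rcol h j y), val h j y n c

/-- The same sum with the DROPPED terms («Y_j not contained in Ω_{k+1}») replaced by `0` (p. 272 L29–31). [cite: Balaban1985UV3, p.272 L29–31] -/
noncomputable def oldSumIn (h : Hist P (k + 1)) : ℝ :=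
  ∑ j ∈ Icc 1 k, ∑ y ∈ oldBlocks M₁ Rcol h j, ∑ n ∈ range (Ndeg j + 1),
    ∑ c ∈ Fintype.piFinset (fun _ : Fin n => oldBonds M₁ Rcol h j y), (if Drop M₁ Rcol h j y n c then 0 else val h j y n c)

/-- At the trivial history the two sums agree (nothing is dropped). [folklore] -/
theorem oldSumIn_triv (htriv : Hist P (k + 1)) (h0 : htriv = Hist.triv P (k + 1)) :
    oldSumIn M₁ Rcol Ndeg val htriv = oldSum M₁ Rcol Ndeg val htriv := by
  subst h0
  unfold oldSumIn oldSum
  refine sum_congr rfl fun j _ => sum_congr rfl fun y _ => sum_congr rfl fun n _ => sum_congr rfl fun c _ => ?_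
  rw [if_neg (not_drop_triv M₁ Rcol j y n c)]

end Sums

end Summit.QuantumFields.Balaban3D.Carriers
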